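import Literature.Computability.Complexity.ExtMonotoneGRankSupport
import Literature.Computability.Complexity.CircuitComposition
import Literature.Computability.AlgebraicComplexity.DeterminantalComplexity

/-!
# PneNP / ConvexRankGates — crux `LinAlgGateBlind` (stmt-PneNP-10681), negative side, I:
# an affine determinantal representation is ONE GRANK gate computing the monotone shadow

Negative-side support (standing disprover, `Cruxes/LinAlgGateBlind/Disproof.lean`). A GRANK gate
(`IsGRankGate`, `ExtMonotoneGates.lean`) accepts iff the generic rank of an affine symbolic matrix
with the unselected variables killed reaches a threshold `θ`. Here: an affine determinantal
representation `det A = P` of size `d` (tree: `HasDetRepr`, `IsAffineDetRepr`) IS such a gate with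
`θ = d`, `K₀ = A(0)`, `Kᵢ = ∂A/∂Xᵢ` (`detGate_isGRankGate`, `symbolicPolyMatrix_coeff_eq` from the
affine decomposition `eq_C_add_sum_X_mul_C`), and it accepts `v` iff some monomial of `P` has all
its variables on in `v` — the MONOTONE SHADOW of `P` (`detGate_eq_true_iff`: rank `= d` iff
`det ≠ 0`, `le_rank_iff_det_ne_zero`; minors commute with killing variables, tree
`killVars_ne_zero_iff`). Hence `cktSize_shadow_of_hasDetRepr`: a size-`1` circuit over `GRANK_d`
computes the shadow. Sequels: `CliquePolyDetRepr.lean` (the clique polynomial and its explicit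
determinantal representation), `ValiantCertificate.lean` (the crux implies superpolynomial
determinantal complexity of the clique polynomials over every field).
-/

namespace Summit.PneNP.PneNP.Theorems.LinAlgGateBlind.Negative

open Literature.Computability.Complexity MvPolynomial

section Affine

variable {R : Type*} [CommSemiring R] {n : ℕ}

/-- A finitely supported function of degree `1` is a `single i 1`. [folklore] -/
theorem finsupp_eq_single_of_degree_eq_one {ι : Type*} (d : ι →₀ ℕ) (hd : d.degree = 1) :
    ∃ j, d = Finsupp.single j 1 := by
  classical
  have hne : d ≠ 0 := by
    rintro rfl
    simp at hd
  obtain ⟨j, hj⟩ := Finsupp.support_nonempty_iff.2 hne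
  refine ⟨j, ?_⟩
  have hj1 : 1 ≤ d j := Nat.one_le_iff_ne_zero.2 (Finsupp.mem_support_iff.1 hj)
  have hsum : d.degree = ∑ i ∈ d.support, d i := rfl
  have hle : d j ≤ ∑ i ∈ d.support, d i :=
    Finset.single_le_sum (fun i _ => Nat.zero_le (d i)) hj
  have hdj : d j = 1 := by omega
  -- all other coordinates vanish
  ext i
  by_cases hij : i = j
  · subst hij; simp [hdj]
  · rw [Finsupp.single_apply, if_neg (Ne.symm hij)]
    by_contra hi
    have hi' : i ∈ d.support := Finsupp.mem_support_iff.2 hi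
    have h2 : d j + d i ≤ ∑ l ∈ d.support, d l := by
      rw [← Finset.sum_pair (Ne.symm hij)]
      exact Finset.sum_le_sum_of_subset_of_nonneg
        (by intro x hx; simp only [Finset.mem_insert, Finset.mem_singleton] at hx
            rcases hx with rfl | rfl <;> assumption)
        (fun _ _ _ => Nat.zero_le _)
    have : 1 ≤ d i := Nat.one_le_iff_ne_zero.2 hi
    omega

/-- **Affine polynomials, coefficientwise.** A polynomial of total degree `≤ 1` in finitely many
variables is `c₀ + ∑ᵢ Xᵢ cᵢ` with `c₀` its constant coefficient and `cᵢ` the coefficient of `Xᵢ`.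
[folklore] -/
theorem eq_C_add_sum_X_mul_C (a : MvPolynomial (Fin n) R) (ha : a.totalDegree ≤ 1) :
    a = C (a.coeff 0) + ∑ i, X i * C (a.coeff (Finsupp.single i 1)) := by
  classical
  refine MvPolynomial.ext _ _ fun d => ?_
  simp only [coeff_add, coeff_C, coeff_sum]
  have hterm : ∀ i : Fin n, coeff d (X i * C (a.coeff (Finsupp.single i 1))) =
      if d = Finsupp.single i 1 then a.coeff (Finsupp.single i 1) else 0 := by
    intro i
    rw [mul_comm, coeff_C_mul, coeff_X]
    by_cases h : d = Finsupp.single i 1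
    · subst h; simp
    · rw [if_neg h, if_neg (fun h' => h h'.symm), mul_zero]
  simp only [hterm]
  by_cases h0 : d = 0
  · subst h0
    have : ∀ i : Fin n, ((0 : Fin n →₀ ℕ) = Finsupp.single i 1) = False := fun i => by
      refine propext ⟨fun h => ?_, False.elim⟩
      have := congrArg (fun f => f i) h
      simp at this
    simp [this]
  · rw [if_neg (fun h => h0 h.symm), zero_add]
    by_cases h1 : d.degree = 1
    · obtain ⟨j, rfl⟩ := finsupp_eq_single_of_degree_eq_one d h1
      rw [Finset.sum_eq_single j]
      · simp
      · intro i _ hij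
        rw [if_neg]
        intro h
        exact hij (Finsupp.single_left_injective (by norm_num) h).symm
      · intro h; exact absurd (Finset.mem_univ j) h
    · -- degree ≥ 2: both sides vanish
      have hdeg : 2 ≤ d.degree := by
        have : d.degree ≠ 0 := fun h => h0 ((Finsupp.degree_eq_zero_iff d).1 h)
        omega
      rw [coeff_eq_zero_of_totalDegree_lt]
      · symm
        refine Finset.sum_eq_zero fun i _ => ?_
        rw [if_neg]
        rintro rfl
        simp [Finsupp.degree_single] at hdeg
      · change a.totalDegree < d.degree
        omega

end Affine

section Rank

variable {K : Type*} [Field K] {d : ℕ}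

/-- For a square matrix over a field: full rank iff non-zero determinant. [folklore] -/
theorem le_rank_iff_det_ne_zero (M : Matrix (Fin d) (Fin d) K) : d ≤ M.rank ↔ M.det ≠ 0 := by
  constructor
  · intro h hdet
    have hr : M.rank = d := le_antisymm (by simpa using M.rank_le_card_width) h
    have htop : LinearMap.range M.mulVecLin = ⊤ :=
      Submodule.eq_top_of_finrank_eq (by rw [← Matrix.rank, hr]; simp)
    have hsurj : Function.Surjective M.mulVec := fun y => by
      have : y ∈ LinearMap.range M.mulVecLin := htop ▸ Submodule.mem_top
      obtain ⟨x, hx⟩ := this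
      exact ⟨x, hx⟩
    have hU : IsUnit M := Matrix.mulVec_surjective_iff_isUnit.1 hsurj
    exact ((Matrix.isUnit_iff_isUnit_det M).1 hU).ne_zero hdet
  · intro h
    simpa using Literature.LinearAlgebra.Matrix.card_le_rank_of_det_submatrix_ne_zero M id id
      (by simpa using h)

end Rank

section OneGate

variable {F : Type} [Field F] {n d : ℕ}

/-- An affine matrix IS the generic symbolic matrix of its constant part `A.map (coeff 0)` and its
`Xᵢ`-coefficient matrices `A.map (coeff (single i 1))`. [folklore] -/
theorem symbolicPolyMatrix_coeff_eq (A : Matrix (Fin d) (Fin d) (MvPolynomial (Fin n) F))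
    (hA : ∀ p q, (A p q).totalDegree ≤ 1) :
    symbolicPolyMatrix (A.map (coeff 0)) (fun i => A.map (coeff (Finsupp.single i 1))) = A := by
  ext p q
  simp only [symbolicPolyMatrix, Matrix.add_apply, Matrix.map_apply, Matrix.sum_apply,
    Matrix.smul_apply, smul_eq_mul]
  conv_rhs => rw [eq_C_add_sum_X_mul_C (A p q) (hA p q)]

/-- The **determinant gate** of an affine `d × d` matrix `A` in `n` variables — arity `n`, accepts `v`
iff the generic rank of `A` with the unselected variables killed is `d` — is a GRANK gate of
dimension `d` (field `F`, `θ = d`, `K₀ = A(0)`, `Kᵢ = ∂A/∂Xᵢ`). [folklore] -/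
theorem detGate_isGRankGate (A : Matrix (Fin d) (Fin d) (MvPolynomial (Fin n) F)) :
    IsGRankGate d ⟨n, fun v => decide (d ≤ (symbolicMatrix (A.map (coeff 0))
      (fun i => A.map (coeff (Finsupp.single i 1))) v).rank)⟩ :=
  ⟨F, inferInstance, d, d, le_rfl, _, _, fun _ => decide_eq_true_iff⟩

/-- **Semantics of the determinant gate**: for an affine matrix `A`, the gate accepts `v` iff some
monomial of `det A` has all its variables switched on in `v` (the monotone SHADOW / support
up-closure of `det A`). [folklore] -/
theorem detGate_eq_true_iff (A : Matrix (Fin d) (Fin d) (MvPolynomial (Fin n) F))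
    (hA : ∀ p q, (A p q).totalDegree ≤ 1) (v : Fin n → Bool) :
    decide (d ≤ (symbolicMatrix (A.map (coeff 0)) (fun i => A.map (coeff (Finsupp.single i 1))) v).rank)
        = true ↔ ∃ s ∈ (A.det).support, ∀ i ∈ s.support, v i = true := by
  rw [decide_eq_true_iff, le_rank_iff_det_ne_zero, ← Matrix.submatrix_id_id (symbolicMatrix _ _ v),
    Ne, det_submatrix_symbolicMatrix_eq_zero_iff, Matrix.submatrix_id_id,
    symbolicPolyMatrix_coeff_eq A hA, ← Ne, killVars_ne_zero_iff]

end OneGate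

section OneGateCircuits

variable {F : Type} [Field F]

/-- **One-gate lemma.** An affine determinantal representation of size `d` of `P` in `n` variables
gives, for any wiring of the variables to inputs, a size-`1` circuit over `GRANK_d` computing the
monotone shadow of `P`. [folklore] -/
theorem cktSize_shadow_of_hasDetRepr {n d : ℕ} {P : MvPolynomial (Fin n) F}
    (h : Literature.Computability.AlgebraicComplexity.HasDetRepr P d) {ι : Type*} (w : Fin n → ι) :
    CktSize {g | IsGRankGate d g}
      (fun (x : ι → Bool) (_ : Unit) => decide (∃ s ∈ P.support, ∀ i ∈ s.support, x (w i) = true))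
      1 := by
  obtain ⟨A, hA, hdet⟩ := h
  refine (CktSize.gate (B := {g | IsGRankGate d g}) _ (detGate_isGRankGate A) w).congr fun x _ => ?_
  apply Bool.eq_iff_iff.2
  rw [detGate_eq_true_iff A hA, decide_eq_true_iff, hdet]

end OneGateCircuits

end Summit.PneNP.PneNP.Theorems.LinAlgGateBlind.Negative
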